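import Summits.BirchSwinnertonDyer.BirchSwinnertonDyer.Theorems.PublishedInputsGreenbergLemma34KernelCoinvariants
import Summits.BirchSwinnertonDyer.BirchSwinnertonDyer.Theorems.PublishedInputsGreenbergLayerCocycles
import Literature.NumberTheory.EllipticCurves.AnticyclotomicSignedLocalConditions
import HarnessLib

set_option linter.dupNamespace false -- `…BirchSwinnertonDyer.BirchSwinnertonDyer…` is the cell's nested layout (D-0017)
set_option autoImplicit false

/-!
# Greenberg LNM 1716 Lemma 3.4 at the layers `n ≥ 1`, brick 4: `#𝒦_{E,n}[p^∞] = #(E(K_{∞,η})/(g^{pⁿ} − 1))[p^∞]` EXACTLY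

Seat `bsd-inputs-k4-p1` (gen 6; LADDER-BSD D-0154 KEY (147)(f) «prove the printed input», row 1 K4 INPUTS; Greenberg
1999), `--supports stmt-BirchSwinnertonDyer-20309`. THEOREMS ONLY (no definition, no named fact, no `sorry`).

R. Greenberg, *Iwasawa theory for elliptic curves*, LNM 1716 (1999), §3 (pp. 86–89): `ker(r_{v_n}) ≅ H¹(Γ_{v_n}, E(K_{∞,η}))`
with `Γ_{v_n} = Gal(K_{∞,η}/K_{n,v_n}) ≅ pⁿℤ_p` pro-cyclic on `γ_{v_n}`, so `#ker(r_{v_n})[p^∞] = #(E(K_{∞,η})/(γ_{v_n} − 1))[p^∞]`.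
Gen 5 proved this at the layer `n = 0` (`InputsGreenbergLemma34.natCard_localTowerKerPrimary_zero_eq_of_isTopGenerator`);
cell bsd-2adic has the INJECTION at every layer (BRICK 11). This file is the EQUALITY at every layer `n`, for a
`ℤ_p`-extension `κ` of `K` whose localisation `κ ∘ res : Γ_E → Γ_K → ℤ_p` to the `K`-field `E` is still surjective
(`ZpExtension.localize`; for `E = ℚ_v`, `v ∣ p`, `κ` cyclotomic this is total ramification of `p` in `ℚ_∞`) and a
topological generator `g` of the localised extension: the generator of the layer `n` is `g^{pⁿ}`. Ingredients: gen 5's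
generic count `natCard_primary_subgroupResKer_eq_of_cocycles` on the open subgroup `H_{E,n} = Gal(K̄_E/K_n E)`, the
identification `𝒦_{E,n} = ker(res : H¹(H_{E,n}, E(K̄_E)) → H¹(H_{E,∞}, ·))`, and the layer-`n` inflation cocycles
(`InputsGreenbergLemma34Layer.exists_layerCocycle_vanishing_apply_eq_of_nsmul_eq_sub`).

* **`natCard_localTowerKerPrimary_eq_of_isTopGenerator`** — `#𝒦_{E,n}[p^∞] = #(E(K̄_E)^{H_{E,∞}}/(g^{pⁿ} − 1))[p^∞]`
  (as `Nat.card`, finite or not).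

HONEST FRAMING: TOOL theorem; closes nothing; no summit statement is proved; BSD is not proved by any of this.

References: [GreenbergLNM1716] §3 Lemmas 3.1–3.4 (pp. 86–89); [SerreGaloisCohomology1997] I.§2.6, XIII.§1;
[HatleyLeiVigni2022] §3.1 (localised `ℤ_p`-extension).
-/

noncomputable section

open scoped Classical

universe u

namespace Summit.BirchSwinnertonDyer.BirchSwinnertonDyer.Theorems.InputsGreenbergLemma34Layer

open Literature.NumberTheory.EllipticCurves Literature.NumberTheory.GaloisRepresentations
  Literature.NumberTheory.EllipticCurves.ResKernel Literature.NumberTheory.EllipticCurves.PrimaryCoinvariants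
  Literature.NumberTheory.EllipticCurves.LayerCocycle ZpExtension WeierstrassCurve
  Summit.BirchSwinnertonDyer.BirchSwinnertonDyer.Theorems.InputsGreenbergLemma34

variable {E : Type u} [Field E] [CharZero E] {p : ℕ} [hp : Fact p.Prime]
  {K : Type u} [Field K] (W : WeierstrassCurve K) (κ : ZpExtension K p) [Algebra K E]

set_option maxHeartbeats 800000 in
/-- **`#𝒦_{E,n}[p^∞] = #(E(K̄_E)^{H_{E,∞}}/(g^{pⁿ} − 1))[p^∞]` at EVERY layer `n`.** For an elliptic curve `W/K`, a
`ℤ_p`-extension `κ` of `K`, a `K`-field `E` of characteristic `0` such that `κ ∘ res_E : Γ_E → ℤ_p` is surjective (`h`;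
the localised `ℤ_p`-extension `κ_E = κ.localize` then has kernel `H_{E,∞} = Gal(K̄_E/K_∞E)` and layers
`H_{E,n} = Gal(K̄_E/K_nE)`), and a topological generator `g` of `κ_E`: both sides as `Nat.card` (finite or not).
Layer-`n` form of gen 5's `natCard_localTowerKerPrimary_zero_eq_of_isTopGenerator`: the generic count on `H_{E,n}` with
`N = H_{E,∞}` and generator `g^{pⁿ}`, fed by the layer-`n` inflation cocycles. Greenberg, LNM 1716, §3:
"`ker(r_{v_n}) ≅ H¹(Γ_{v_n}, E(K_{∞,η}))`" with `Γ_{v_n}` pro-cyclic.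
[cite: GreenbergLNM1716, §3 Lemmas 3.3–3.4 (pp. 86–89)] [cite: SerreGaloisCohomology1997, I.§2.6, XIII.§1] -/
theorem natCard_localTowerKerPrimary_eq_of_isTopGenerator
    (h : Function.Surjective (κ.toContinuousMonoidHom.comp (resGal (K := K) E)))
    {g : Field.absoluteGaloisGroup E} (hγ : (κ.localize (closureEmb (K := K) E) h).IsTopGenerator g) (n : ℕ) :
    Nat.card (W.localTowerKerPrimary κ E n) =
      Nat.card (AddCommGroup.primaryComponent
        (FixedPoints.addSubgroup (localSubgroup κ.kerSubgroup E) (localPoints W E) ⧸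
          (subOne (localSubgroup κ.kerSubgroup E) (localPoints W E) (g ^ p ^ n)).range) p) := by
  -- adapted from Summits/.../Theorems/PublishedInputsGreenbergLemma34KernelCoinvariants.lean (gen 5, layer 0)
  -- notation (as in the tree's `finite_localTowerKerPrimary_and_card_le`)
  let κE : ZpExtension E p := κ.localize (closureEmb (K := K) E) h
  let P : Type u := localPoints W E
  let Hn : Subgroup (Field.absoluteGaloisGroup E) := localSubgroup (κ.layerSubgroup n) E
  let Hi : Subgroup (Field.absoluteGaloisGroup E) := localSubgroup κ.kerSubgroup E
  let N : Subgroup Hn := Hi.subgroupOf Hn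
  -- the localised extension has `ker κE = H_{E,∞}` and `κE⁻¹(pⁿℤ_p) = H_{E,n}` (definitionally)
  have hker : κE.kerSubgroup = Hi := rfl
  have hlay : κE.layerSubgroup n = Hn := rfl
  have hg : g ^ p ^ n ∈ Hn := hlay ▸ pow_mem_layerSubgroup κE hγ n
  let γ : Hn := ⟨g ^ p ^ n, hg⟩
  have hle : Hi ≤ Hn := WeierstrassCurve.localSubgroup_ker_le_layer κ E n
  -- (1) generation inside `H_{E,n}` (from `κE`)
  have hgen : ∀ U : Subgroup (Field.absoluteGaloisGroup E),
      IsOpen (U : Set (Field.absoluteGaloisGroup E)) → Hi ≤ U → g ^ p ^ n ∈ U → Hn ≤ U := by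
    intro U hU hNU hgU
    exact hlay ▸ κE.layerSubgroup_le_of_isOpen hγ n U hU (hker ▸ hNU) hgU
  have hgen' : ∀ U : Subgroup Hn, IsOpen (U : Set Hn) → N ≤ U → γ ∈ U → U = ⊤ := by
    intro U hU hNU hγU
    let U' : Subgroup (Field.absoluteGaloisGroup E) := U.map Hn.subtype
    have hopen : IsOpen (U' : Set (Field.absoluteGaloisGroup E)) :=
      (isOpen_localSubgroup_layerSubgroup E κ n).isOpenMap_subtype_val _ hU
    have hN' : Hi ≤ U' := fun τ hτ ↦
      ⟨⟨τ, hle hτ⟩, hNU (Subgroup.mem_subgroupOf.mpr hτ), rfl⟩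
    have hγU' : g ^ p ^ n ∈ U' := ⟨γ, hγU, rfl⟩
    have hle' := hgen U' hopen hN' hγU'
    rw [eq_top_iff]
    intro x _
    obtain ⟨u, hu, hux⟩ := hle' x.2
    have : u = x := Subtype.ext hux
    exact this ▸ hu
  -- (2) orbit maps on `H_{E,n}`
  have hcont : ∀ m : P, Continuous fun x : Hn ↦ x • m := fun m ↦
    (continuous_smul_localPoints W E m).comp continuous_subtype_val
  -- (3) `P^N = P^{H_{E,∞}}`, compatibly with `g^{pⁿ} − 1` and `p`-power torsion
  have hfix : FixedPoints.addSubgroup N P = FixedPoints.addSubgroup Hi P := by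
    ext m
    simp only [FixedPoints.mem_addSubgroup]
    constructor
    · intro h' τ
      exact h' ⟨⟨τ, hle τ.2⟩, Subgroup.mem_subgroupOf.mpr τ.2⟩
    · intro h' x
      exact h' ⟨((x : Hn) : Field.absoluteGaloisGroup E), Subgroup.mem_subgroupOf.mp x.2⟩
  let e : FixedPoints.addSubgroup N P ≃+ FixedPoints.addSubgroup Hi P :=
    AddEquiv.addSubgroupCongr hfix
  have he : AddSubgroup.map (e : FixedPoints.addSubgroup N P →+ FixedPoints.addSubgroup Hi P)
      (subOne N P γ).range = (subOne Hi P (g ^ p ^ n)).range := by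
    ext b
    constructor
    · rintro ⟨x, ⟨y, rfl⟩, rfl⟩
      exact ⟨e y, Subtype.ext rfl⟩
    · rintro ⟨y, rfl⟩
      exact ⟨subOne N P γ (e.symm y), ⟨e.symm y, rfl⟩, Subtype.ext rfl⟩
  let eq : FixedPoints.addSubgroup N P ⧸ (subOne N P γ).range ≃+
      FixedPoints.addSubgroup Hi P ⧸ (subOne Hi P (g ^ p ^ n)).range :=
    QuotientAddGroup.congr _ _ e he
  let ep : AddCommGroup.primaryComponent (FixedPoints.addSubgroup N P ⧸ (subOne N P γ).range) p ≃
      AddCommGroup.primaryComponent (FixedPoints.addSubgroup Hi P ⧸ (subOne Hi P (g ^ p ^ n)).range) p :=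
    eq.toEquiv.subtypeEquiv fun a ↦ by
      simp only [AddCommGroup.mem_primaryComponent, AddEquiv.toEquiv_eq_coe, EquivLike.coe_coe]
      constructor
      · rintro ⟨k, hk⟩
        exact ⟨k, by rw [← map_nsmul, hk, map_zero]⟩
      · rintro ⟨k, hk⟩
        refine ⟨k, eq.injective ?_⟩
        rw [map_nsmul, hk, map_zero]
  have hcardp : Nat.card (AddCommGroup.primaryComponent
      (FixedPoints.addSubgroup N P ⧸ (subOne N P γ).range) p) =
      Nat.card (AddCommGroup.primaryComponent
        (FixedPoints.addSubgroup Hi P ⧸ (subOne Hi P (g ^ p ^ n)).range) p) :=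
    Nat.card_congr ep
  -- (hinf): inflation cocycles on `H_{E,n}` for torsion classes, from `κE` (brick 3)
  have hinfN : ∀ b : FixedPoints.addSubgroup N P,
      (∃ k : ℕ, p ^ k • (QuotientAddGroup.mk b : FixedPoints.addSubgroup N P ⧸ (subOne N P γ).range) = 0) →
      ∃ ψ : contOneCocycles (discreteTopRep Hn P), (∀ n ∈ N, ψ.1 n = 0) ∧ ψ.1 γ = b := by
    rintro b ⟨k, hk⟩
    rw [← QuotientAddGroup.mk_nsmul, QuotientAddGroup.eq_zero_iff] at hk
    obtain ⟨y, hy⟩ := hk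
    have hbk : p ^ k • (b : P) = (g ^ p ^ n) • (y : P) - y := by
      have h' := congrArg (fun z : FixedPoints.addSubgroup N P ↦ (z : P)) hy
      simp only [coe_subOne_apply, AddSubmonoidClass.coe_nsmul] at h'
      exact h'.symm
    have hbfix : ∀ τ ∈ κE.kerSubgroup, τ • (b : P) = b := fun τ hτ ↦ (e b).2 ⟨τ, hker ▸ hτ⟩
    have hyfix : ∀ τ ∈ κE.kerSubgroup, τ • (y : P) = y := fun τ hτ ↦ (e y).2 ⟨τ, hker ▸ hτ⟩
    obtain ⟨ψ, hψN, hψg⟩ := exists_layerCocycle_vanishing_apply_eq_of_nsmul_eq_sub κE hγ n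
      (continuous_smul_localPoints W E) (b : P) hbfix hyfix hbk
    refine ⟨ψ, fun x hx ↦ hψN x (hker ▸ Subgroup.mem_subgroupOf.mp hx), hψg⟩
  -- (4) the generic count on `H_{E,n}`
  have hcount := natCard_primary_subgroupResKer_eq_of_cocycles N P γ hgen' hcont p hinfN
  -- (5) `𝒦_{E,n} = ker (res : H¹(H_{E,n}, P) → H¹(N, P))`
  let j : N →ₜ* Hi :=
    { toFun := fun x ↦ ⟨((x : Hn) : Field.absoluteGaloisGroup E), Subgroup.mem_subgroupOf.mp x.2⟩
      map_one' := rfl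
      map_mul' := fun _ _ ↦ rfl
      continuous_toFun :=
        (continuous_subtype_val.comp continuous_subtype_val).subtype_mk _ }
  have hcomp : (resH1Hom j (AddMonoidHom.id P) (fun _ _ ↦ rfl)).comp
      (Literature.NumberTheory.EllipticCurves.resOfLe P hle) = resSubgroup N P := by
    unfold Literature.NumberTheory.EllipticCurves.resOfLe ResKernel.resSubgroup
    rw [resH1Hom_comp]
    exact resH1Hom_congr (ContinuousMonoidHom.ext fun _ ↦ rfl) (AddMonoidHom.ext fun _ ↦ rfl) _ _
  have hkerEq : W.localTowerKer κ E n = subgroupResKer P N := by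
    apply le_antisymm
    · intro c hc
      rw [mem_subgroupResKer_iff, ← hcomp, AddMonoidHom.comp_apply,
        (W.mem_localTowerKer_iff κ E n c).mp hc, map_zero]
    · intro c hc
      obtain ⟨φ, rfl, hφN⟩ := exists_cocycle_of_res_eq_zero N P hcont c hc
      rw [W.mem_localTowerKer_iff κ E n]
      change Literature.NumberTheory.EllipticCurves.resOfLe P hle (oneCocycleClass _ φ) = 0
      have h0 : oneCocycleClass _ (contOneCocycles.pullback (subgroupInclusion hle)
          (resHomOfEquivariant (subgroupInclusion hle) (AddMonoidHom.id P) (fun _ _ ↦ rfl)) φ) = 0 := by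
        rw [oneCocycleClass_eq_zero_iff]
        refine ⟨0, fun τ ↦ ?_⟩
        rw [map_zero, sub_zero, contOneCocycles.pullback_apply]
        exact hφN ⟨(τ : Field.absoluteGaloisGroup E), hle τ.2⟩ (Subgroup.mem_subgroupOf.mpr τ.2)
      rw [← map_oneCocycleClass] at h0
      exact h0
  -- (6) `𝒦_{E,n}[p^∞] ≃ {x ∈ ker res | p-power torsion}`
  let f : W.localTowerKerPrimary κ E n ≃ {x : subgroupResKer P N // ∃ k : ℕ, p ^ k • x = 0} :=
    { toFun := fun c ↦ ⟨⟨(c : discreteH1 Hn P), hkerEq.le ((W.mem_localTowerKerPrimary_iff κ E n _).mp c.2).1⟩, by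
        obtain ⟨k, hk⟩ := ((W.mem_localTowerKerPrimary_iff κ E n _).mp c.2).2
        exact ⟨k, Subtype.ext hk⟩⟩
      invFun := fun x ↦ ⟨((x.1 : subgroupResKer P N) : discreteH1 Hn P),
        (W.mem_localTowerKerPrimary_iff κ E n _).mpr ⟨hkerEq.symm.le x.1.2, by
          obtain ⟨k, hk⟩ := x.2
          exact ⟨k, by
            have := congrArg (fun z : subgroupResKer P N ↦ (z : discreteH1 Hn P)) hk
            simpa only [AddSubgroupClass.coe_nsmul, ZeroMemClass.coe_zero] using this⟩⟩⟩
      left_inv := fun c ↦ Subtype.ext rfl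
      right_inv := fun x ↦ Subtype.ext (Subtype.ext rfl) }
  rw [Nat.card_congr f, hcount, hcardp]

end Summit.BirchSwinnertonDyer.BirchSwinnertonDyer.Theorems.InputsGreenbergLemma34Layer

end
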